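import Summits.QuantumAdvantage.QuantumAdvantage.Theorems.StabilizerDialAntipodalD

/-! # StabilizerDialAntipodal — part 5/5 (mechanical split for landing of `StabilizerDialAntipodal`; content verbatim; scopes re-opened with their variables) -/

set_option linter.dupNamespace false
noncomputable section
open scoped Classical

namespace Summit.QuantumAdvantage.QuantumAdvantage.Theorems.StabilizerDial
open Finset
open Literature.Computability.QuantumComplexity Literature.Computability.QuantumComplexity.RingHLF
open Literature.Computability.MetaComplexity Literature.Computability.MetaComplexity.Smolensky
open Summit.QuantumAdvantage.AdviceFreeQNC0
open Summit.QuantumAdvantage.QuantumAdvantage.Theorems.HolonomyDial (selP selP_mem selP_apply xorP xorP_mem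
  xorP_apply_bool tPoly tPoly_mem tPoly_apply mono_singleton_apply card_odd_le)
open Summit.QuantumAdvantage.QuantumAdvantage.Theorems.AnchorDial (outB dev card_odd_ge)
open Summit.QuantumAdvantage.QuantumAdvantage.Theorems.LocusDial (Coverable FewLocus)
variable {N : ℕ}

/-! ## §C  Growth bookkeeping (proved) -/

/-- StabilizerDialAntipodal helper `natSqrt_le_half` (antipodal certificate; see the module docstring). -/
theorem natSqrt_le_half {n : ℕ} (hn : 16 ≤ n) : Nat.sqrt n ≤ n / 2 := by
  have h1 : Nat.sqrt n * Nat.sqrt n ≤ n := Nat.sqrt_le n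
  have h2 : 4 ≤ Nat.sqrt n := by
    rw [show (4 : ℕ) = Nat.sqrt 16 by norm_num]
    exact Nat.sqrt_le_sqrt hn
  rw [Nat.le_div_iff_mul_le (by norm_num)]
  nlinarith

/-- for every `K, E`: eventually `K · (log₂ n)^E ≤ n / 2` and `16 ≤ log₂ n`. -/
theorem eventually_polylog (K E : ℕ) : ∃ n₀ : ℕ, ∀ n ≥ n₀, K * (Nat.log 2 n) ^ E ≤ n / 2 ∧ 16 ≤ Nat.log 2 n := by
  obtain ⟨n₁, hn₁⟩ := TubePlanProof.logPow_le_natSqrt (E + 1)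
  refine ⟨max n₁ (max (2 ^ K) (2 ^ 16)), fun n hn => ?_⟩
  have hn1 : n₁ ≤ n := le_trans (le_max_left _ _) hn
  have hnK : 2 ^ K ≤ n := le_trans (le_trans (le_max_left _ _) (le_max_right _ _)) hn
  have hn16 : 2 ^ 16 ≤ n := le_trans (le_trans (le_max_right _ _) (le_max_right _ _)) hn
  have hK : K ≤ Nat.log 2 n := Nat.le_log_of_pow_le (by norm_num) hnK
  have h16 : 16 ≤ Nat.log 2 n := Nat.le_log_of_pow_le (by norm_num) hn16
  refine ⟨?_, h16⟩
  calc K * Nat.log 2 n ^ E ≤ Nat.log 2 n * Nat.log 2 n ^ E := Nat.mul_le_mul_right _ hK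
    _ = Nat.log 2 n ^ (E + 1) := by ring
    _ ≤ Nat.sqrt n := hn₁ n hn1
    _ ≤ n / 2 := natSqrt_le_half (le_trans (by norm_num) hn16)

/-- crude side-condition bookkeeping for the composition. -/
theorem side_bounds (m r P k : ℕ) (hP : 1 ≤ P) (hk : k ≤ 279936 * P) :
    2 * k + 4 ≤ ((32 * m + 40) * 279936 + 32 * (m * r) + 8) * P ∧
      32 * m * (k + r) + k + 1 ≤ ((32 * m + 40) * 279936 + 32 * (m * r) + 8) * P := by
  have ha : 32 * m * k ≤ 32 * m * (279936 * P) := Nat.mul_le_mul_left _ hk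
  have hb : 32 * (m * r) ≤ 32 * (m * r) * P := Nat.le_mul_of_pos_right _ hP
  constructor
  · nlinarith
  · nlinarith

/-! ## §D  The kernel-checked composition -/

/-- **COMPOSITION**: S1, S2, S12 and S3 imply the gating statement. -/
theorem antipodalGenericPos3_of
    (S1 : ∀ N a k : ℕ, 3 ≤ k → 1 ≤ a → a + k + 1 ≤ N / 2 → FibreIdentityAt N a k)
    (S2 : ∀ N : ℕ, OddSliceBound N)
    (S12 : ∀ (N e a k : ℕ) (s : Fin N → CubeFn (ZMod 3) N), (∀ i, s i ∈ lowDeg (ZMod 3) N ((Nat.log 2 N) ^ e)) →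
      3456 * (8 * (Nat.log 2 N) ^ e + 1) ^ 2 ≤ k → 1 ≤ a → a + k + 1 ≤ N / 2 → FibreIdentityAt N a k → OddSliceBound N →
      8 * (univ.filter fun x : Fin N → Bool => OddZeros x ∧ BlockRec s a k x).card ≤ 3 * 2 ^ N)
    (S3 : ∀ (m r k N : ℕ) (s : Fin N → CubeFn (ZMod 3) N), FewLocus m r (pad (fun i => apStrat i) s) → 2 * k + 4 ≤ N / 2 →
      ∃ a : ℕ, 1 ≤ a ∧ a + k + 1 ≤ N / 2 ∧
        (N / 2 - k - 1) * Nat.log 2 N * (univ.filter fun x : Fin N → Bool => OddZeros x ∧ ¬ BlockRec s a k x).card ≤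
          (N / 2 - k - 1) * 2 ^ (N - 1) + Nat.log 2 N * (2 * m * (k + r)) * 2 ^ (N - 1)) :
    AntipodalGenericPos3 := by
  intro m r e
  -- the constant: k(n) := 3456 · (8 (log₂ n)^e + 1)² ≤ 279936 · (log₂ n)^{2e}; all side conditions ≤ K · (log₂ n)^{2e}
  set K : ℕ := (32 * m + 40) * 279936 + 32 * (m * r) + 8 with hKdef
  obtain ⟨n₀, hn₀⟩ := eventually_polylog K (2 * e)
  refine ⟨n₀, fun n hn hStab => ?_⟩
  obtain ⟨hKn, hL⟩ := hn₀ n hn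
  obtain ⟨s, hs, hF⟩ := hStab
  set L := Nat.log 2 n with hLdef
  set k : ℕ := 3456 * (8 * L ^ e + 1) ^ 2 with hkdef
  -- (i) size of k
  have hL1 : 1 ≤ L := le_trans (by norm_num) hL
  have hLe : 1 ≤ L ^ e := Nat.one_le_pow _ _ hL1
  have hk_le : k ≤ 279936 * L ^ (2 * e) := by
    have h81 : (8 * L ^ e + 1) ^ 2 ≤ 81 * (L ^ e) ^ 2 := by nlinarith
    calc k = 3456 * (8 * L ^ e + 1) ^ 2 := rfl
      _ ≤ 3456 * (81 * (L ^ e) ^ 2) := Nat.mul_le_mul_left _ h81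
      _ = 279936 * L ^ (2 * e) := by ring
  have hLL : 1 ≤ L ^ (2 * e) := Nat.one_le_pow _ _ hL1
  -- (ii) the side conditions, all from `K · L^{2e} ≤ n/2`
  have hside : 2 * k + 4 ≤ n / 2 ∧ 32 * m * (k + r) + k + 1 ≤ n / 2 := by
    obtain ⟨h1, h2⟩ := side_bounds m r (L ^ (2 * e)) k hLL hk_le
    exact ⟨le_trans h1 hKn, le_trans h2 hKn⟩
  obtain ⟨hk2, hmk⟩ := hside
  -- (iii) block selection
  obtain ⟨a, ha1, hak, hBad⟩ := S3 m r k n s hF hk2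
  -- (iv) the good set is small
  have hk3 : 3 ≤ k := by
    calc (3 : ℕ) ≤ 3456 * 1 := by norm_num
      _ ≤ 3456 * (8 * L ^ e + 1) ^ 2 := Nat.mul_le_mul_left _ (Nat.one_le_pow _ _ (by omega))
  have hGood := S12 n e a k s hs (le_of_eq hkdef.symm) ha1 hak (S1 n a k hk3 ha1 hak) (S2 n)
  -- (v) count: #odd ≤ #Good + #Bad, #odd ≥ 2^{n-1}
  set G := (univ.filter fun x : Fin n → Bool => OddZeros x ∧ BlockRec s a k x).card with hGdef
  set Bd := (univ.filter fun x : Fin n → Bool => OddZeros x ∧ ¬ BlockRec s a k x).card with hBdef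
  have hn3 : 3 ≤ n := by
    have : 2 * k + 4 ≤ n := le_trans hk2 (Nat.div_le_self _ _)
    omega
  have hOdd : 2 ^ (n - 1) ≤ G + Bd := by
    calc 2 ^ (n - 1) ≤ (univ.filter fun x : Fin n → Bool => OddZeros x).card := card_odd_ge (by omega)
      _ ≤ G + Bd := by
        rw [hGdef, hBdef, ← Finset.card_union_of_disjoint]
        · refine card_le_card fun x hx => ?_
          rw [mem_filter] at hx
          rw [mem_union, mem_filter, mem_filter]
          by_cases hB : BlockRec s a k x
          · exact Or.inl ⟨hx.1, hx.2, hB⟩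
          · exact Or.inr ⟨hx.1, hx.2, hB⟩
        · rw [Finset.disjoint_left]
          intro x h1 h2
          rw [mem_filter] at h1 h2
          exact h2.2.2 h1.2.2
  -- (vi) arithmetic: A := n/2 - k - 1 ≥ 32 m (k + r) > 0, L ≥ 16
  set A := n / 2 - k - 1 with hAdef
  have hA : 32 * m * (k + r) ≤ A := by rw [hAdef]; omega
  have hApos : 1 ≤ A := by rw [hAdef]; omega
  -- from S3: A·L·Bd ≤ A·2^{n-1} + L·2m(k+r)·2^{n-1} ≤ A·2^{n-1} + L·A·2^{n-1}/16
  have hP : 0 < 2 ^ (n - 1) := Nat.two_pow_pos _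
  have hBd16 : 16 * (A * L * Bd) ≤ A * L * 2 ^ (n - 1) + 2 * (A * L * 2 ^ (n - 1)) := by
    have h1 : 16 * (A * 2 ^ (n - 1)) ≤ A * L * 2 ^ (n - 1) := by
      calc 16 * (A * 2 ^ (n - 1)) = A * 16 * 2 ^ (n - 1) := by ring
        _ ≤ A * L * 2 ^ (n - 1) := Nat.mul_le_mul_right _ (Nat.mul_le_mul_left _ hL)
    have h2 : 16 * (L * (2 * m * (k + r)) * 2 ^ (n - 1)) ≤ 2 * (A * L * 2 ^ (n - 1)) := by
      have : 16 * (2 * m * (k + r)) ≤ A := by nlinarith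
      calc 16 * (L * (2 * m * (k + r)) * 2 ^ (n - 1)) = (16 * (2 * m * (k + r))) * L * 2 ^ (n - 1) := by ring
        _ ≤ A * L * 2 ^ (n - 1) := Nat.mul_le_mul_right _ (Nat.mul_le_mul_right _ this)
        _ ≤ 2 * (A * L * 2 ^ (n - 1)) := by omega
    calc 16 * (A * L * Bd) ≤ 16 * (A * 2 ^ (n - 1) + L * (2 * m * (k + r)) * 2 ^ (n - 1)) :=
          Nat.mul_le_mul_left _ hBad
      _ = 16 * (A * 2 ^ (n - 1)) + 16 * (L * (2 * m * (k + r)) * 2 ^ (n - 1)) := by ring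
      _ ≤ _ := Nat.add_le_add h1 h2
  -- hence 16·Bd ≤ 3·2^{n-1}
  have hBd : 16 * Bd ≤ 3 * 2 ^ (n - 1) := by
    have hAL : 0 < A * L := Nat.mul_pos (by omega) (by omega)
    have : A * L * (16 * Bd) ≤ A * L * (3 * 2 ^ (n - 1)) := by
      calc A * L * (16 * Bd) = 16 * (A * L * Bd) := by ring
        _ ≤ A * L * 2 ^ (n - 1) + 2 * (A * L * 2 ^ (n - 1)) := hBd16
        _ = A * L * (3 * 2 ^ (n - 1)) := by ring
    exact Nat.le_of_mul_le_mul_left this hAL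
  -- and 16·G ≤ 12·2^{n-1}
  have hG : 16 * G ≤ 12 * 2 ^ (n - 1) := by
    have h2n : 2 ^ n = 2 ^ (n - 1) * 2 := by
      conv_lhs => rw [show n = (n - 1) + 1 by omega]
      exact pow_succ 2 (n - 1)
    have h8 : 8 * G ≤ 3 * (2 ^ (n - 1) * 2) := h2n ▸ hGood
    omega
  -- contradiction: 16·2^{n-1} ≤ 16(G + Bd) ≤ 15·2^{n-1}
  have := Nat.mul_le_mul_left 16 hOdd
  omega

/-- **THE GATING THEOREM.** -/
theorem antipodalGenericPos3 : AntipodalGenericPos3 :=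
  antipodalGenericPos3_of fibreIdentityAt_of_block oddSliceBound_holds goodBound_of_blockRec blockSelect_of_fewLocus

/-- **CLASS NON-EMPTINESS for the residual `StabGenericLossPos3`**: at every `(m, r, c)` with `c ≥ 1`, eventually some
degree-`(log₂ n)^c` strategy is NOT turned into an `(m+1, r)`-few-locus strategy by any gauge of degree `(log₂ n)^{c+1}`. -/
theorem antipodal_class_nonempty (m r c : ℕ) (hc : 1 ≤ c) :
    ∃ n₀ : ℕ, ∀ n ≥ n₀, ∃ P : Fin n → CubeFn (ZMod 3) n,
      (∀ i, P i ∈ lowDeg (ZMod 3) n ((Nat.log 2 n) ^ c)) ∧ ¬ StabFew (m + 1) r (c + 1) P := by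
  obtain ⟨n₀, hn₀⟩ := antipodalGenericPos3 (m + 1) r (c + 1)
  refine ⟨max n₀ 8, fun n hn => ⟨fun i => apStrat i, fun i => ?_, hn₀ n (le_trans (le_max_left _ _) hn)⟩⟩
  have h8 : 2 ^ 3 ≤ n := le_trans (le_max_right _ _) hn
  have hL : 3 ≤ Nat.log 2 n := Nat.le_log_of_pow_le (by norm_num) h8
  have h3 : 3 ≤ (Nat.log 2 n) ^ c :=
    calc 3 ≤ Nat.log 2 n := hL
      _ = (Nat.log 2 n) ^ 1 := (pow_one _).symm
      _ ≤ (Nat.log 2 n) ^ c := Nat.pow_le_pow_right (by omega) hc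
  exact lowDeg_mono h3 (apStrat_mem i)

end Summit.QuantumAdvantage.QuantumAdvantage.Theorems.StabilizerDial
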